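import Literature.IUT.LogThetaLattice.PacketLogVolumesHaarModelCapsulesDegree
import Literature.IUT.LogVolume.TensorPacketBridge
import HarnessLib

/-!
# [IUTchIII] Proposition 3.9 (iii) for CAPSULES at the genuine adelic Haar model, VIII: the SINGLETON capsule —
# `(R_I)^∼` is compact for EVERY `|I| ≥ 1`, and the degree clause `μ^log_{A,𝕍_ℚ}(𝔍) = deg_{F_mod}(𝔍)/[F_mod:ℚ]` holds for
# EVERY finite nonempty label set `A` (abc-iut cell, layer L6; row CAP39 part VIII, abc-iut-L6-d3)

S. Mochizuki, *Inter-universal Teichmüller theory III*, kurims manuscript (May 2020), Proposition 3.9 (i), p. 115: "for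
`A` a finite nonempty set [of capsule indices] … when `|A| = 1`, i.e., `A = {α}`, we write `μ^log_{α,v_ℚ}`"; (iii), p. 117:
"the global log-volume `μ^log_{A,𝕍_ℚ}(𝔍)` is equal to the degree of the arithmetic line bundle determined by `𝔍` …,
relative to a suitable normalization" [claim: Mochizuki2012, status: disputed]. *Inter-universal Teichmüller theory IV*,
Proposition 1.1, p. 9 ("`I` a finite set of cardinality `≥ 2` … `p^{d_{I*}}·(R_I)^∼ ⊆ R_I`") and Proposition 1.4 (i), p. 13
("tensor products of finitely many finite extensions of `ℚ_p` … decompose … we obtain a notion of log-volume …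
normalized so that `μ^log((R_E)^∼) = 0`").

WHAT THIS FILE ADDS. Part IV of the row (`PacketLogVolumesHaarModelCapsulesDegree.lean`, p419946) proves the degree clause
at the genuine `A`-packets `⊕_{(v_β)} ⊗_β F_{v_β}` under the hypothesis `hA : 2 ≤ |A|`, inherited from campaign-S's typing
of [IUTchIV] Prop. 1.1 (`prop11_holds`, `isCompact_normalizedPacket_of_two_le`): the compactness of the integral structure
`(R_I)^∼` — which is what makes the normalisation `μ^log((R_I)^∼) = 0` honest — was available for `|I| ≥ 2` only. Print's
`A` is ANY finite nonempty set, and for `|I| = 1` the statement is trivial: `V = ⊗_{ℚ_p}^{i ∈ I} k_i ≅ k_{i₀}` and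
`(R_I)^∼ = 𝒪_{k_{i₀}}`. Here:
* §1 `packetSubsingletonAlgEquiv p k i₀ : (⊗_{ℚ_p}^{i∈I} k_i) ≃ₐ[ℚ_p] k_{i₀}` for a subsingleton index set (Mathlib's
  dependent `PiTensorProduct.subsingletonEquiv`, made multiplicative through `PiTensorProduct.liftAlgHom`), and the
  ONE-FACTOR decomposition `packetSubsingletonDecomposition : V ≃ₐ[ℚ_p] (Unit → k_{i₀})`;
* §2 **`isCompact_normalizedPacket_of_subsingleton`** (abc-iut-S7's `isCompact_normalizedPacket_of_decomposition` at that
  decomposition: `(R_I)^∼ = ψ⁻¹(𝒪_{k_{i₀}})`), the decomposition-free integral structure **`normalizedIntegralStructure p k`**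
  (= S7's `normalizedStructure p k L ψ` for any `ψ`) and `haar_normalizedPacket_pos_lt_top'` for EVERY finite nonempty `I`
  (case split `|I| ≤ 1` / `|I| ≥ 2`);
* §3 the `hA`-free regions of `𝔍 = {J_v}` in the label `α` — `integralPortionRegion` (= part IV's `nonarchUnitRegion … hA`
  when `2 ≤ |A|`), `idealPortionRegion`, `idealCapsuleRegionAt`, `idealCapsuleRegion` (= part IV's `capsuleIdealRegion …
  hA`, `idealCapsuleRegion_eq_capsuleIdealRegion`) — with the same log-volume computations, and
  **`prop39iii_degree_haarModelCapsules [Nonempty A] (α) : Prop39iii_degree (capsulePacketLogVolume F A)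
  (idealCapsuleRegion F A α) IdealFamily.deg`** with `c = 1/[F_mod:ℚ]` for EVERY finite nonempty `A`; packet by packet the
  capsule log-volume of `𝔍` is p416411's single-place `haarPacketLogVolume F q (haarIdealRegion F 𝔍)`
  (`capsulePacketLogVolume_idealCapsuleRegionAt`) — at `|A| = 1` this is the kernel junction between the singleton-capsule
  model and the single-place model of record (plan/L6/SUBDAG-IUTchIII-Prop-39 row iii.r20).

HONEST SCOPE. `K = F_mod = F` (the relative case is abc-iut-w5-d083's `PacketLogVolumesHaarModelRelativeTensorDegree.lean`,
whose `hA` can be dropped the same way); `⊗_ℝ` of copies of `ℂ` at `∞` (faithful for totally complex `F`, automatic under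
[IUTchI] Def. 3.1 (a) `√−1 ∈ F`); the objects `𝔍` are families of fractional ideals / dilated discs (Example 3.6 (ii)
objects — no Frobenioid is constructed). Nothing here bears on [IUTchIII] Cor. 3.12 or takes a side; typed ≠ endorsed.
Classical mathematics. [cite: Mochizuki2012, IUTchIV Prop. 1.4 (i) p. 13]
-/

noncomputable section

/-! ### §1 The one-factor tensor packet `⊗_{ℚ_p}^{i ∈ I} k_i ≅ k_{i₀}` (`|I| = 1`) -/

namespace Literature.IUT.LogVolume

open MeasureTheory Set

section Subsingleton

variable (p : ℕ) [Fact p.Prime] {I : Type}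
variable (k : I → Type) [∀ i, NontriviallyNormedField (k i)] [∀ i, NormedAlgebra ℚ_[p] (k i)]

/-- Evaluation at `i₀` as a multilinear map `(Π_i k_i) → k_{i₀}` when the index set is a subsingleton (the multilinear
map underlying Mathlib's `PiTensorProduct.subsingletonEquiv`). [cite: Mochizuki2012, IUTchIV Prop. 1.4 (i) p. 13] -/
def packetEvalMultilinear [Subsingleton I] (i₀ : I) : MultilinearMap ℚ_[p] k (k i₀) where
  toFun f := f i₀
  map_update_add' m i := by rw [Subsingleton.elim i i₀]; simp
  map_update_smul' m i := by rw [Subsingleton.elim i i₀]; simp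

/-- Unfolding `packetEvalMultilinear`. [cite: Mochizuki2012, IUTchIV Prop. 1.4 (i) p. 13] -/
@[simp] theorem packetEvalMultilinear_apply [Subsingleton I] (i₀ : I) (f : Π i, k i) :
    packetEvalMultilinear p k i₀ f = f i₀ := rfl

/-- **`V = ⊗_{ℚ_p}^{i∈I} k_i → k_{i₀}` as a `ℚ_p`-ALGEBRA homomorphism** for a subsingleton `I` (`⊗_i x_i ↦ x_{i₀}` is
multiplicative and unital). [cite: Mochizuki2012, IUTchIV Prop. 1.4 (i) p. 13] -/
def packetSubsingletonAlgHom [Subsingleton I] (i₀ : I) : PacketAlgebra p k →ₐ[ℚ_[p]] k i₀ :=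
  PiTensorProduct.liftAlgHom (packetEvalMultilinear p k i₀) rfl fun _ _ => rfl

/-- On pure tensors: `⊗_i x_i ↦ x_{i₀}`. [cite: Mochizuki2012, IUTchIV Prop. 1.4 (i) p. 13] -/
@[simp] theorem packetSubsingletonAlgHom_purePacket [Subsingleton I] (i₀ : I) (x : Π i, k i) :
    packetSubsingletonAlgHom p k i₀ (purePacket p k x) = x i₀ := by
  show PiTensorProduct.lift (packetEvalMultilinear p k i₀) (PiTensorProduct.tprod ℚ_[p] x) = x i₀
  rw [PiTensorProduct.lift.tprod, packetEvalMultilinear_apply]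

/-- The algebra homomorphism IS Mathlib's linear `PiTensorProduct.subsingletonEquiv i₀` (both are the lift of the
evaluation at `i₀`). [cite: Mochizuki2012, IUTchIV Prop. 1.4 (i) p. 13] -/
theorem packetSubsingletonAlgHom_apply [Subsingleton I] (i₀ : I) (x : PacketAlgebra p k) :
    packetSubsingletonAlgHom p k i₀ x = PiTensorProduct.subsingletonEquiv i₀ x := by
  induction x using PiTensorProduct.induction_on with
  | smul_tprod r f =>
      rw [map_smul, map_smul, PiTensorProduct.subsingletonEquiv_apply_tprod]
      exact congrArg (r • ·) (packetSubsingletonAlgHom_purePacket p k i₀ f)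
  | add x y hx hy => rw [map_add, map_add, hx, hy]

/-- **The one-factor tensor packet: `V = ⊗_{ℚ_p}^{i∈I} k_i ≃ₐ[ℚ_p] k_{i₀}` for a subsingleton index set `I`.**
[cite: Mochizuki2012, IUTchIV Prop. 1.4 (i) p. 13] -/
def packetSubsingletonAlgEquiv [Subsingleton I] (i₀ : I) : PacketAlgebra p k ≃ₐ[ℚ_[p]] k i₀ :=
  AlgEquiv.ofLinearEquiv (PiTensorProduct.subsingletonEquiv i₀)
    (by rw [← packetSubsingletonAlgHom_apply, map_one])
    (fun x y => by simp only [← packetSubsingletonAlgHom_apply, map_mul])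

/-- Unfolding: the equivalence is `PiTensorProduct.subsingletonEquiv i₀` on elements.
[cite: Mochizuki2012, IUTchIV Prop. 1.4 (i) p. 13] -/
@[simp] theorem packetSubsingletonAlgEquiv_apply [Subsingleton I] (i₀ : I) (x : PacketAlgebra p k) :
    packetSubsingletonAlgEquiv p k i₀ x = PiTensorProduct.subsingletonEquiv i₀ x := rfl

/-- On pure tensors: `⊗_i x_i ↦ x_{i₀}`. [cite: Mochizuki2012, IUTchIV Prop. 1.4 (i) p. 13] -/
@[simp] theorem packetSubsingletonAlgEquiv_purePacket [Subsingleton I] (i₀ : I) (x : Π i, k i) :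
    packetSubsingletonAlgEquiv p k i₀ (purePacket p k x) = x i₀ :=
  PiTensorProduct.subsingletonEquiv_apply_tprod i₀ x

/-- **The ONE-FACTOR DECOMPOSITION `V ≃ₐ[ℚ_p] ∏_{j ∈ {*}} k_{i₀}`** — the case `J = {*}` of "tensor products of finitely
many finite extensions of `ℚ_p` … decompose [into direct products of fields]" ([IUTchIV] Prop. 1.4 (i), p. 13), in the
shape consumed by abc-iut-S7/S8's decomposition theorems. [cite: Mochizuki2012, IUTchIV Prop. 1.4 (i) p. 13] -/
def packetSubsingletonDecomposition [Subsingleton I] (i₀ : I) : PacketAlgebra p k ≃ₐ[ℚ_[p]] (Unit → k i₀) :=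
  (packetSubsingletonAlgEquiv p k i₀).trans (AlgEquiv.funUnique ℚ_[p] Unit (k i₀)).symm

/-- Unfolding the one-factor decomposition. [cite: Mochizuki2012, IUTchIV Prop. 1.4 (i) p. 13] -/
@[simp] theorem packetSubsingletonDecomposition_apply [Subsingleton I] (i₀ : I) (x : PacketAlgebra p k) (u : Unit) :
    packetSubsingletonDecomposition p k i₀ x u = packetSubsingletonAlgEquiv p k i₀ x := rfl

/-! ### §2 `(R_I)^∼` is compact for every finite nonempty `I` -/

variable [Fintype I] [DecidableEq I] [∀ i, IsUltrametricDist (k i)] [∀ i, ProperSpace (k i)]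

/-- **`(R_I)^∼` is compact for `|I| = 1`**: under the one-factor decomposition `ψ : V ≃ k_{i₀}`, `ψ((R_I)^∼) = 𝒪_{k_{i₀}}`
(abc-iut-S8's `image_normalizedPacket`: `ψ` preserves `ℤ_p`-integrality), a compact set — the degenerate case NOT covered
by the printed Prop. 1.1 (which assumes `|I| ≥ 2`) and needing no different bound (abc-iut-S7's
`isCompact_normalizedPacket_of_decomposition`). [cite: Mochizuki2012, IUTchIV Prop. 1.4 (i) p. 13] -/
theorem isCompact_normalizedPacket_of_subsingleton [Nonempty I] [Subsingleton I] :
    IsCompact (normalizedPacket p k : Set (PacketAlgebra p k)) := by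
  obtain ⟨i₀⟩ := ‹Nonempty I›
  exact isCompact_normalizedPacket_of_decomposition p k (fun _ : Unit => k i₀) (packetSubsingletonDecomposition p k i₀)

/-- **`(R_I)^∼` as an INTEGRAL STRUCTURE of `V = ⊗ k_i` (a compact open additive subgroup) for EVERY finite nonempty
index set `I`, with no decomposition datum**: open as in abc-iut-S7's `isOpen_normalizedPacket`; COMPACT by [IUTchIV]
Prop. 1.1 for `|I| ≥ 2` (campaign-S `prop11_holds`, abc-iut-L6-d3's `isCompact_normalizedPacket_of_two_le`) and by the
one-factor case `isCompact_normalizedPacket_of_subsingleton` for `|I| = 1`. (S7's `normalizedStructure p k L ψ` is the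
same object GIVEN a decomposition `ψ`: `normalizedIntegralStructure_eq_normalizedStructure`.)
[cite: Mochizuki2012, IUTchIV Prop. 1.1 p. 9] -/
def normalizedIntegralStructure [Nonempty I] : IntegralStructure (PacketAlgebra p k) :=
  ⟨⟨(normalizedPacket p k).toAddSubgroup, isOpen_normalizedPacket p k⟩, by
    rcases Nat.lt_or_ge (Fintype.card I) 2 with h | h
    · haveI : Subsingleton I := Fintype.card_le_one_iff_subsingleton.mp (by omega)
      exact isCompact_normalizedPacket_of_subsingleton p k
    · exact Literature.IUT.LogThetaLattice.isCompact_normalizedPacket_of_two_le p k h⟩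

/-- Unfolding `normalizedIntegralStructure`: its carrier is `(R_I)^∼`. [cite: Mochizuki2012, IUTchIV Prop. 1.1 p. 9] -/
@[simp] theorem coe_normalizedIntegralStructure [Nonempty I] :
    (normalizedIntegralStructure p k : Set (PacketAlgebra p k)) = normalizedPacket p k := rfl

/-- Given a decomposition `ψ : V ≃ₐ ∏_j L_j`, abc-iut-S7's `normalizedStructure p k L ψ` IS `normalizedIntegralStructure p k`
(same carrier; the compactness witnesses are propositions). [cite: Mochizuki2012, IUTchIV Prop. 1.4 (i) p. 13] -/
theorem normalizedIntegralStructure_eq_normalizedStructure [Nonempty I] {J : Type} [Fintype J] (L : J → Type)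
    [∀ j, NontriviallyNormedField (L j)] [∀ j, NormedAlgebra ℚ_[p] (L j)] [∀ j, IsUltrametricDist (L j)]
    [∀ j, ProperSpace (L j)] (ψ : PacketAlgebra p k ≃ₐ[ℚ_[p]] (Π j, L j)) :
    normalizedIntegralStructure p k = normalizedStructure p k L ψ := rfl

/-- Hence `(R_I)^∼` has positive finite Haar measure for every finite nonempty `I` (a compact open subring), so that
the normalisation `μ^log((R_I)^∼) = 0` of `tensorLogVolume` is honest for every capsule size (part IV's
`haar_normalizedPacket_pos_lt_top hI` without `2 ≤ |I|`). [cite: Mochizuki2012, IUTchIV Prop. 1.4 (i) p. 13] -/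
theorem haar_normalizedPacket_pos_lt_top' [Nonempty I] :
    0 < (integerStructure p k).haar (normalizedPacket p k : Set (PacketAlgebra p k)) ∧
      (integerStructure p k).haar (normalizedPacket p k : Set (PacketAlgebra p k)) < ⊤ :=
  ⟨(integerStructure p k).haar_pos_of_isOpen (isOpen_normalizedPacket p k) ⟨1, (normalizedPacket p k).one_mem⟩,
    (integerStructure p k).haar_lt_top_of_isCompact (normalizedIntegralStructure p k).isCompact⟩

end Subsingleton

end Literature.IUT.LogVolume

/-! ### §3 The degree clause at the genuine capsule model for EVERY finite nonempty `A` -/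

namespace Literature.IUT.LogThetaLattice

open Literature.IUT.LogVolume Literature.NumberTheory.NumberFields NumberField IsDedekindDomain MeasureTheory Set
open scoped ENNReal NNReal

variable (F : Type) [Field F] [NumberField F]
variable (A : Type) [Fintype A] [DecidableEq A] [Nonempty A]

section Nonarch

variable (p : Nat.Primes) [Fact (p : ℕ).Prime] (vA : A → {v : HeightOneSpectrum (𝓞 F) // v ∈ placesOver F (p : ℕ)})

/-- **The integral structure `(R_I)^∼ ⊆ ⊗_β F_{v_β}` as an admissible region, for EVERY finite nonempty `A`** — "the
elements of "`𝕄(−)`" given by the [products of the] integral structures … on each of the direct summand … fields"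
([IUTchIII] Prop. 3.9 (i) p. 115); part IV's `nonarchUnitRegion … hA` without the hypothesis `2 ≤ |A|`.
[claim: Mochizuki2012, status: disputed] -/
def integralPortionRegion : (nonarchPortion F A p vA).Adm :=
  ⟨(normalizedPacket p (fun α => Kp F p (vA α)) : Set (PacketAlgebra p (fun α => Kp F p (vA α)))),
    haar_normalizedPacket_pos_lt_top' p (fun α => Kp F p (vA α))⟩

/-- It IS part IV's `nonarchUnitRegion` whenever `2 ≤ |A|` (same set). [claim: Mochizuki2012, status: disputed] -/
@[simp] theorem nonarchUnitRegion_eq_integralPortionRegion (hA : 2 ≤ Fintype.card A) :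
    nonarchUnitRegion F A p vA hA = integralPortionRegion F A p vA := rfl

/-- Its log-volume is `0` ("log-volume … equal to zero", Prop. 3.9 (i); campaign-S `tensorLogVolume_normalizedPacket`,
honest since `(R_I)^∼` is compact for every `|A| ≥ 1`). [claim: Mochizuki2012, status: disputed] -/
theorem nonarchPortion_logVol_integralPortionRegion :
    (nonarchPortion F A p vA).logVol (integralPortionRegion F A p vA).1 = 0 :=
  tensorLogVolume_normalizedPacket p (fun α => Kp F p (vA α))

/-- **The region of `J = 𝔭_{v_α}^{-n}𝒪` in the label `α` of the portion `⊗_β F_{v_β}`**, for every finite nonempty `A`: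
`ι_α(ϖ_{v_α}^{-n})·(R_I)^∼`. [claim: Mochizuki2012, status: disputed] -/
def idealPortionRegion (α : A) (n : ℤ) : (nonarchPortion F A p vA).Adm :=
  (nonarchPortion F A p vA).actAdm α (idealGenAt F (vA α).1 n) (integralPortionRegion F A p vA)

/-- It IS part IV's `nonarchIdealPortionRegion` whenever `2 ≤ |A|`. [claim: Mochizuki2012, status: disputed] -/
@[simp] theorem nonarchIdealPortionRegion_eq_idealPortionRegion (hA : 2 ≤ Fintype.card A) (α : A) (n : ℤ) :
    nonarchIdealPortionRegion F A p vA hA α n = idealPortionRegion F A p vA α n := rfl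

/-- Its log-volume: `μ^log(ι_α(ϖ^{-n})·(R_I)^∼) = n·log q_{v_α}/[F_{v_α}:ℚ_p]` (dimension-normalised `μ^log`).
[claim: Mochizuki2012, status: disputed] -/
theorem nonarchPortion_logVol_idealPortionRegion' (α : A) (n : ℤ) :
    (nonarchPortion F A p vA).logVol (idealPortionRegion F A p vA α n).1 =
      n * logNorm F (vA α).1 / localDegree F (vA α).1 := by
  rw [idealPortionRegion, CapsuleDatum.logVol_actAdm, nonarchPortion_logVol_integralPortionRegion, zero_add,
    nonarchPortion_shift, log_adicAbv_idealGenAt]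

end Nonarch

/-- **The region of `𝔍` in the label `α` of the portion `π` at `v_ℚ`**, for every finite nonempty `A`
(`ι_α(ϖ^{-n})·(R_I)^∼` at `p`, the `e^{t}`-dilated polydisc at `∞`). [claim: Mochizuki2012, status: disputed] -/
def idealCapsuleRegionAt (α : A) (J : IdealFamily F) :
    (q : RatPlace) → (π : Portion F A q) → (portionDatum F A q π).Adm
  | Sum.inl (), π => archIdealPortionRegion F A (fun β => packetInftyEquiv F (π β)) α (J.arch (packetInftyEquiv F (π α)))
  | Sum.inr p, π =>
      haveI : Fact (p : ℕ).Prime := ⟨p.2⟩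
      idealPortionRegion F A p (fun β => packetPrimeEquiv F p (π β)) α (J.fin (packetPrimeEquiv F p (π α)).1)

/-- It IS part IV's `capsuleIdealRegionAt … hA` whenever `2 ≤ |A|`. [claim: Mochizuki2012, status: disputed] -/
theorem capsuleIdealRegionAt_eq_idealCapsuleRegionAt (hA : 2 ≤ Fintype.card A) (α : A) (J : IdealFamily F)
    (q : RatPlace) : capsuleIdealRegionAt F A hA α J q = idealCapsuleRegionAt F A α J q := by
  rcases q with ⟨⟩ | p <;> rfl

/-- **Its portion log-volume is the per-place term at `π(α)`** (part IV `idealTerm`). [claim: Mochizuki2012, status: disputed] -/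
theorem portionDatum_logVol_idealCapsuleRegionAt (α : A) (J : IdealFamily F) (q : RatPlace) (π : Portion F A q) :
    (portionDatum F A q π).logVol (idealCapsuleRegionAt F A α J q π).1 = idealTerm F J (π α).1 := by
  rcases q with ⟨⟩ | p
  · show (archPortion F A _).logVol (archIdealPortionRegion F A _ α _).1 = _
    rw [archPortion_logVol_idealPortionRegion]
    generalize π α = v
    rcases v with ⟨w | w, h⟩
    · rfl
    · exact absurd h (ratPlaceBelow_inr_ne_infty F w)
  · haveI : Fact (p : ℕ).Prime := ⟨p.2⟩
    show (nonarchPortion F A p _).logVol (idealPortionRegion F A p _ α _).1 = _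
    rw [nonarchPortion_logVol_idealPortionRegion']
    generalize π α = v
    rcases v with ⟨w | w, h⟩
    · exact absurd h (ratPlaceBelow_inl_ne_prime F w p)
    · rfl

/-- **At every `v_ℚ` the `A`-packet log-volume of `𝔍`-in-label-`α` equals the single-place packet log-volume of `𝔍`**
(p416411's `haarIdealRegion`), for EVERY finite nonempty `A` — at `|A| = 1` this is the junction between the
singleton-capsule model and the single-place model of record: `Σ_π (∏_β ω(π β))·term(π α) = Σ_v ω_v·term_v =
Σ_v c_v·μ^log_v(J_v)`. [claim: Mochizuki2012, status: disputed] -/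
theorem capsulePacketLogVolume_idealCapsuleRegionAt (α : A) (J : IdealFamily F) (q : RatPlace) :
    capsulePacketLogVolume F A q (idealCapsuleRegionAt F A α J q) =
      haarPacketLogVolume F q ((haarIdealRegion F J).1 q) := by
  unfold capsulePacketLogVolume portionWeight
  simp_rw [portionDatum_logVol_idealCapsuleRegionAt]
  rw [sum_pi_prod_mul_apply A (fun v : Packet F q => placeProbWeight F v.1) (fun v => idealTerm F J v.1)
    (sum_packet_placeProbWeight F q) α]
  simp only [haarPacketLogVolume, haarIdealRegion_apply]
  exact Finset.sum_congr rfl fun v _ => placeProbWeight_mul_idealTerm F J v.1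

/-- **The region of `𝔍` in the label `α`** as a GLOBAL region of the `A`-packets, for every finite nonempty `A` ("zero
log-volume for all but finitely many `v_ℚ`"). [claim: Mochizuki2012, status: disputed] -/
def idealCapsuleRegion (α : A) (J : IdealFamily F) : GlobalRegion (capsulePacketLogVolume F A) :=
  ⟨idealCapsuleRegionAt F A α J, by
    have h := (haarIdealRegion F J).2
    refine h.subset fun q hq => ?_
    rw [Function.mem_support, capsulePacketLogVolume_idealCapsuleRegionAt] at hq
    exact Function.mem_support.mpr hq⟩

/-- Components of the global region of `𝔍`. [claim: Mochizuki2012, status: disputed] -/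
@[simp] theorem idealCapsuleRegion_apply (α : A) (J : IdealFamily F) (q : RatPlace) :
    (idealCapsuleRegion F A α J).1 q = idealCapsuleRegionAt F A α J q := rfl

/-- It IS part IV's `capsuleIdealRegion … hA` whenever `2 ≤ |A|`. [claim: Mochizuki2012, status: disputed] -/
theorem capsuleIdealRegion_eq_idealCapsuleRegion (hA : 2 ≤ Fintype.card A) (α : A) (J : IdealFamily F) :
    capsuleIdealRegion F A hA α J = idealCapsuleRegion F A α J :=
  Subtype.ext (funext fun q => capsuleIdealRegionAt_eq_idealCapsuleRegionAt F A hA α J q)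

/-- **`μ^log_{A,𝕍_ℚ}(𝔍) = μ^log_{𝕍_ℚ}(𝔍)`** (the single-place global log-volume), for every finite nonempty `A` and every
label. [claim: Mochizuki2012, status: disputed] -/
theorem globalLogVolume_idealCapsuleRegion_eq (α : A) (J : IdealFamily F) :
    globalLogVolume (capsulePacketLogVolume F A) (idealCapsuleRegion F A α J) =
      globalLogVolume (haarPacketLogVolume F) (haarIdealRegion F J) := by
  unfold globalLogVolume
  exact finsum_congr fun q => capsulePacketLogVolume_idealCapsuleRegionAt F A α J q

/-- **`μ^log_{A,𝕍_ℚ}(𝔍) = deg_F(𝔍)/[F:ℚ]`** for EVERY finite nonempty `A` and every label `α` (p416411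
`globalLogVolume_haarIdealRegion`). [claim: Mochizuki2012, status: disputed] -/
theorem globalLogVolume_idealCapsuleRegion (α : A) (J : IdealFamily F) :
    globalLogVolume (capsulePacketLogVolume F A) (idealCapsuleRegion F A α J) = J.deg / Module.finrank ℚ F := by
  rw [globalLogVolume_idealCapsuleRegion_eq, globalLogVolume_haarIdealRegion]

/-- The same with the tree's normalised degree `ndeg` ([IUTchIV] Def. 1.9 (i)): `μ^log_{A,𝕍_ℚ}(𝔍) = deg(𝔞_𝔍)` on the nose.
[claim: Mochizuki2012, status: disputed] -/
theorem globalLogVolume_idealCapsuleRegion_eq_ndeg (α : A) (J : IdealFamily F) :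
    globalLogVolume (capsulePacketLogVolume F A) (idealCapsuleRegion F A α J) = ndeg F J.toADivisor := by
  rw [globalLogVolume_idealCapsuleRegion_eq, globalLogVolume_haarIdealRegion_eq_ndeg]

/-- **IUTchIII:Prop3.9(iii)** (kurims p. 117) DEGREE CLAUSE AT THE GENUINE MODEL FOR CAPSULES OF EVERY SIZE: for every
finite nonempty label set `A` (`|A| = 1` included) and every label `α ∈ A`, abc-iut-L6-t4's `Prop39iii_degree
(capsulePacketLogVolume F A) (idealCapsuleRegion F A α) IdealFamily.deg` HOLDS with the normalisation constant
`c = 1/[F:ℚ]` — ONE "suitable normalization" for all capsules and all labels (part IV's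
`prop39iii_degree_haarModelCapsules_general` without `2 ≤ |A|`; p416411's `prop39iii_degree_haarModel` is the
single-place form). [claim: Mochizuki2012, status: disputed] -/
theorem prop39iii_degree_haarModelCapsules (α : A) :
    Prop39iii_degree (capsulePacketLogVolume F A) (idealCapsuleRegion F A α) IdealFamily.deg :=
  ⟨1 / Module.finrank ℚ F, div_pos one_pos (FinDivisor.finrank_pos (F := F)), fun J => by
    rw [globalLogVolume_idealCapsuleRegion, one_div, ← div_eq_inv_mul]⟩

/-- The unit family `𝒪 = {𝒪_v}` in any label has global log-volume `0`, for every capsule size ("the log-volume of [the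
integral structures] … is equal to zero", Prop. 3.9 (i)). [claim: Mochizuki2012, status: disputed] -/
theorem globalLogVolume_idealCapsuleRegion_unit (α : A) :
    globalLogVolume (capsulePacketLogVolume F A) (idealCapsuleRegion F A α IdealFamily.unit) = 0 := by
  rw [globalLogVolume_idealCapsuleRegion_eq, globalLogVolume_haarIdealRegion_unit]

/-- **Both clauses of Prop. 3.9 (iii) together at the genuine capsule model, every capsule size**: multiplying the region
of `𝔍` in the label `β` by `f ∈ F^×` in ANY label `γ` leaves its global log-volume `deg_F(𝔍)/[F:ℚ]` unchanged (part II
`prop39iii_invariance_haarModelCapsules_general`, which never needed `2 ≤ |A|`). [claim: Mochizuki2012, status: disputed] -/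
theorem globalLogVolume_capsulePacketAction_idealCapsuleRegion (β γ : A) (f : Fˣ) (J : IdealFamily F) :
    globalLogVolume (capsulePacketLogVolume F A) (capsulePacketAction F A γ f (idealCapsuleRegion F A β J)) =
      J.deg / Module.finrank ℚ F := by
  rw [globalLogVolume_capsulePacketAction, globalLogVolume_idealCapsuleRegion]

end Literature.IUT.LogThetaLattice

end
-- buildfix (abc-iut-L6-d3 g4, 2026-08-26T06:4xZ): comment-only enqueue re-land of p426201 (STRANDED ACCEPT 05:45Z, ops/buildfix/UNBUILT-ACCEPTED-20260826T0600.txt l.1188); no declaration changed.
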